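import Summits.QuantumFields.BalabanUV.T4Continuum.Support.GradedWellData
import Summits.QuantumFields.BalabanUV.T4Continuum.Support.DirichletRegionTower

/-!
# T⁴ programme, spine node NE2 (U1a), sub-row Δ1 — THE GRADED WELL, file 7: THE TORUS TRANSFER — King's injected law of the
# graded well FROM THE FAITHFUL UNIT TORUS LAW (a THEOREM, `KingPairingPlantedLaw.injected_le_lev`) and the two-level convergence of
# the LEVEL-FREE-RANK difference `E_k = Δ_a^{(k)} − regionGW_k`; (GW-L) leaves the critical path (owner item O16-f, ruling R49)

Row NE2 OWNER (unit `b2b-balaban-t4-ne2-p1`, gen 16).  After R47/R48 the graded-well tower needed (GW-L) (the injected law of the LOCAL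
operator `localGW`) as the base of O15's resolvent transfer (`GradedWellResolventTower`).  leaf-03-g9's (GW-L) sketch (journal l.25499) takes
as base an operator whose law IS in the tree.  THIS FILE records the owner's consequence (R49): take the base to be Bałaban's FAITHFUL UNIT
TORUS OPERATOR `Δ_a^{(k)} = calDalev L M a ha k` ITSELF — same bond space `idx L M k`, same planting `JpcT = JK` — whose King injected law
`‖(Δ_a^{(k+1)})⁻¹J_k − J_k(Δ_a^{(k)})⁻¹‖ ≤ CJ·L^{−k}` is `KingPairingPlantedLaw.injected_le_lev` (from B5's Plancherel chain) and whose
coercivity `gamD` is `DirichletRegionTower.coercive_calDalev`.  The difference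
`E_k := Δ_a^{(k)} − regionGW_k = ∂·(P_GW − P_T)·∂ᴴ + a·(n^d Q_1ᴴQ_1 − Q_GWᴴQ_GW)` (torus gauge sandwich minus graded gauge sandwich,
unit line mass minus graded line mass) has LEVEL-FREE RANK and LEVEL-FREE NORM, so the generic split `RegionGaugeResolventSplit.
opNorm_injected_le_split` (no smallness of `E` needed) gives

  **`hinjK_GW_of_torus`**: `‖G_GW(k+1)·J_k − J_k·G_GW(k)‖ ≤ ((1 + eγ⁻¹)²·CJ + γ⁻²·Ce)·θ^k` for `k ≥ m`, from (GW-W1)+(GW-S0) (coercivity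
  `γ` of `regionGW`), `‖E_k‖ ≤ e` and ONE two-level leaf **(GW-E)** `‖E_{k+1}J_k − J_kE_k‖ ≤ Ce·θ^k` (`L⁻¹ ≤ θ`).

(GW-E) splits by the triangle inequality (`opNorm_comm_add_le`) into the TORUS sandwich law (tier B4.c/d material at `S = ⊤`, rank #blocks),
the GW sandwich law ((GW-B)(GW-Bᵗ)(GW-K), `GradedWellResolventTower`/leaf-05), the UNIT line-mass commutator (a THEOREM:
`LineAveragingMassCommutator.opNorm_JK_massComm_le`, `≤ 3a/n_k` unsandwiched) and the GRADED line-mass commutator (the scale-`s_i` twin,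
leaf-03-g9's «GradedLineMassCommutator»; measured ≈ 59/n_k on GW₂).  No local law, no Hessian budget, no pairing is needed anywhere.

HONEST FRAMING (T4-DAG p. 1).  [folklore] bookkeeping over landed modules (model level: `U = 1`, one layer map on unit blocks, `m` fixed, finite
torus, operator norm); `γ`, `e`, (GW-E) DISPLAYED; NE2 (U1a) NOT proved; spine PROVED 0/9 unchanged; NOT [B9] (3.16)/(3.23)–(3.27)/(3.42) as
printed; NOT infinite volume / mass gap / Clay.  HONEST DEPENDENCY: continuum YM on T⁴ ⇐ BetaPertH ∧ nine spine estimates (0/9 proved); BetaPertH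
⇐ (D1) ∧ (D4) ∧ CAP+tail; G-an2-4 gates asym, D1 and NE2/3/4.  No `sorry`.
-/

noncomputable section

open scoped BigOperators ComplexConjugate Matrix Matrix.Norms.L2Operator

namespace Summit.QuantumFields.BalabanUV.T4Continuum.GradedWellTorusTransfer

open Literature.MathematicalPhysics.QuantumFieldTheory.Balaban1983to89.B5Prop11Plancherel (Tor fine)
open Literature.MathematicalPhysics.QuantumFieldTheory.Balaban1983to89.B5G183RateUnitTower (lev lev_neZero)
open Summit.QuantumFields.BalabanUV.T4Continuum
open Summit.QuantumFields.BalabanUV.T4Continuum.SubtypeCompression (Coercive isUnit_det_of_coercive opNorm_inv_le_of_coercive)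
open Summit.QuantumFields.BalabanUV.T4Continuum.KingPairingPlantedLaw (JK JpcT calDalev CJ CJ_nonneg opNorm_JpcT_le injected_le_lev)
open Summit.QuantumFields.BalabanUV.T4Continuum.DirichletRegionTower (gamD gamD_pos coercive_calDalev)
open Summit.QuantumFields.BalabanUV.T4Continuum.RegionGaugeResolventSplit (opNorm_injected_le_split)
open Summit.QuantumFields.BalabanUV.T4Continuum.GradedWellData

variable {d : ℕ} (L : ℕ) [NeZero L] (M : Fin d → ℕ) [hM : ∀ μ, NeZero (M μ)] (k m : ℕ) (layer : Tor M → ℕ) (a a' : ℝ) (ha : 0 < a)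

/-- **THE DIFFERENCE `E_k = Δ_a^{(k)} − regionGW_k`** (= torus gauge sandwich − graded gauge sandwich + a·(unit line mass − graded line
mass): LEVEL-FREE rank). [folklore] -/
def EGW : Matrix (TorK L M k × Fin d) (TorK L M k × Fin d) ℂ := calDalev L M a ha k - regionGW L M k m layer a a'

/-- `regionGW = Δ_a − E` (definitional bookkeeping). [folklore] -/
theorem regionGW_eq_calDalev_sub : regionGW L M k m layer a a' = calDalev L M a ha k - EGW L M k m layer a a' ha := by
  unfold EGW; rw [sub_sub_cancel]

/-- the commutator of a sum is the sum of the commutators (norm form) — how (GW-E) splits into the four pieces. [folklore] -/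
theorem opNorm_comm_add_le {v v' : Type*} [Fintype v] [DecidableEq v] [Fintype v'] [DecidableEq v']
    (E₁ E₂ : Matrix v v ℂ) (E₁' E₂' : Matrix v' v' ℂ) (J : Matrix v' v ℂ) :
    ‖(E₁' + E₂') * J - J * (E₁ + E₂)‖ ≤ ‖E₁' * J - J * E₁‖ + ‖E₂' * J - J * E₂‖ := by
  have e : (E₁' + E₂') * J - J * (E₁ + E₂) = (E₁' * J - J * E₁) + (E₂' * J - J * E₂) := by
    rw [Matrix.add_mul, Matrix.mul_add]; abel
  rw [e]; exact norm_add_le _ _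

/-- **THE TORUS TRANSFER, TWO LEVELS** (`regionGW` `γ`-coercive at both levels, `‖E_k‖, ‖E_{k+1}‖ ≤ e`):
`‖G_GW′J − JG_GW‖ ≤ (1 + γ⁻¹e)·‖(Δ_a′)⁻¹J − J(Δ_a)⁻¹‖·(1 + eγ⁻¹) + γ⁻¹·‖E′J − JE‖·γ⁻¹`. [folklore] -/
theorem opNorm_injected_le_of_torus {γ e : ℝ} (hγ : 0 < γ) (he : 0 ≤ e)
    (hco : Coercive (regionGW L M k m layer a a') γ) (hco' : Coercive (regionGW L M (k + 1) m layer a a') γ)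
    (hE : ‖EGW L M k m layer a a' ha‖ ≤ e) (hE' : ‖EGW L M (k + 1) m layer a a' ha‖ ≤ e) :
    ‖(regionGW L M (k + 1) m layer a a')⁻¹ * JpcT L M k - JpcT L M k * (regionGW L M k m layer a a')⁻¹‖
      ≤ (1 + γ⁻¹ * e) * ‖(calDalev L M a ha (k + 1))⁻¹ * JpcT L M k - JpcT L M k * (calDalev L M a ha k)⁻¹‖ * (1 + e * γ⁻¹)
        + γ⁻¹ * ‖EGW L M (k + 1) m layer a a' ha * JpcT L M k - JpcT L M k * EGW L M k m layer a a' ha‖ * γ⁻¹ := by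
  have hX := isUnit_det_of_coercive hγ hco
  have hX' := isUnit_det_of_coercive hγ hco'
  have hY := isUnit_det_of_coercive (gamD_pos (d := d) a) (coercive_calDalev L M a ha k)
  have hY' := isUnit_det_of_coercive (gamD_pos (d := d) a) (coercive_calDalev L M a ha (k + 1))
  have hg : ‖(regionGW L M k m layer a a')⁻¹‖ ≤ γ⁻¹ := opNorm_inv_le_of_coercive hγ hco
  have hg' : ‖(regionGW L M (k + 1) m layer a a')⁻¹‖ ≤ γ⁻¹ := opNorm_inv_le_of_coercive hγ hco'
  have hγ0 : 0 ≤ γ⁻¹ := inv_nonneg.mpr hγ.le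
  have hκ : ‖EGW L M k m layer a a' ha * (regionGW L M k m layer a a')⁻¹‖ ≤ e * γ⁻¹ :=
    (Matrix.l2_opNorm_mul _ _).trans (mul_le_mul hE hg (norm_nonneg _) he)
  have hκ' : ‖(regionGW L M (k + 1) m layer a a')⁻¹ * EGW L M (k + 1) m layer a a' ha‖ ≤ γ⁻¹ * e :=
    (Matrix.l2_opNorm_mul _ _).trans (mul_le_mul hg' hE' (norm_nonneg _) hγ0)
  exact opNorm_injected_le_split hX hY (regionGW_eq_calDalev_sub L M k m layer a a' ha) hX' hY'
    (regionGW_eq_calDalev_sub L M (k + 1) m layer a a' ha) (JpcT L M k) hκ hκ' hg hg' hγ0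

/-- the two-level constant of the torus transfer. [folklore] -/
def C1T (d : ℕ) (a γ e Ce : ℝ) : ℝ := (1 + γ⁻¹ * e) * CJ d a * (1 + e * γ⁻¹) + γ⁻¹ * Ce * γ⁻¹

/-- **`hinjK` FOR THE GRADED WELL FROM THE TORUS LAW AND ONE DIFFERENCE LEAF (GW-E)** (levels `k ≥ m`; `L⁻¹ ≤ θ`; `γ`, `e` level-free):
`‖G_GW(k+1)·J_k − J_k·G_GW(k)‖ ≤ C1T·θ^k` — (GW-L), the local pairing and every Hessian budget are NOT needed. [folklore] -/
theorem hinjK_GW_of_torus {γ e θ Ce : ℝ} (hγ : 0 < γ) (he : 0 ≤ e) (hθ : (L : ℝ)⁻¹ ≤ θ)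
    (hco : ∀ k, m ≤ k → Coercive (regionGW L M k m layer a a') γ)
    (hE : ∀ k, m ≤ k → ‖EGW L M k m layer a a' ha‖ ≤ e)
    (hEc : ∀ k, m ≤ k → ‖EGW L M (k + 1) m layer a a' ha * JpcT L M k - JpcT L M k * EGW L M k m layer a a' ha‖ ≤ Ce * θ ^ k)
    (k : ℕ) (hk : m ≤ k) :
    ‖(regionGW L M (k + 1) m layer a a')⁻¹ * JpcT L M k - JpcT L M k * (regionGW L M k m layer a a')⁻¹‖ ≤ C1T d a γ e Ce * θ ^ k := by
  have hk' : m ≤ k + 1 := Nat.le_succ_of_le hk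
  have hL0 : (0 : ℝ) ≤ (L : ℝ)⁻¹ := inv_nonneg.mpr (Nat.cast_nonneg L)
  have hθ0 : 0 ≤ θ := le_trans hL0 hθ
  have hγ0 : 0 ≤ γ⁻¹ := inv_nonneg.mpr hγ.le
  have h := opNorm_injected_le_of_torus L M k m layer a a' ha hγ he (hco k hk) (hco (k + 1) hk') (hE k hk) (hE (k + 1) hk')
  have hT : ‖(calDalev L M a ha (k + 1))⁻¹ * JpcT L M k - JpcT L M k * (calDalev L M a ha k)⁻¹‖ ≤ CJ d a * θ ^ k :=
    (injected_le_lev L M a ha k).trans (mul_le_mul_of_nonneg_left (pow_le_pow_left₀ hL0 hθ k) (CJ_nonneg d a))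
  have hCe : 0 ≤ Ce * θ ^ k := le_trans (norm_nonneg _) (hEc k hk)
  have h1 : 0 ≤ 1 + γ⁻¹ * e := by have := mul_nonneg hγ0 he; linarith
  have h2 : 0 ≤ 1 + e * γ⁻¹ := by have := mul_nonneg he hγ0; linarith
  calc ‖(regionGW L M (k + 1) m layer a a')⁻¹ * JpcT L M k - JpcT L M k * (regionGW L M k m layer a a')⁻¹‖
      ≤ (1 + γ⁻¹ * e) * ‖(calDalev L M a ha (k + 1))⁻¹ * JpcT L M k - JpcT L M k * (calDalev L M a ha k)⁻¹‖ * (1 + e * γ⁻¹)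
        + γ⁻¹ * ‖EGW L M (k + 1) m layer a a' ha * JpcT L M k - JpcT L M k * EGW L M k m layer a a' ha‖ * γ⁻¹ := h
    _ ≤ (1 + γ⁻¹ * e) * (CJ d a * θ ^ k) * (1 + e * γ⁻¹) + γ⁻¹ * (Ce * θ ^ k) * γ⁻¹ := by
        gcongr
        exact hEc k hk
    _ = C1T d a γ e Ce * θ ^ k := by unfold C1T; ring

end Summit.QuantumFields.BalabanUV.T4Continuum.GradedWellTorusTransfer

end
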